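import Mathlib
import Literature.Analysis.FluidPDE.SelfSimilar
import Literature.Analysis.FluidPDE.TypeIAncientMild
import Literature.Analysis.FluidPDE.CurlFreeLiouville
import Summits.NavierStokesRegularity.NavierStokesRegularity.Theorems.SymmetryModuliCountStretchingCertificateComparison
import Summits.NavierStokesRegularity.NavierStokesRegularity.Theorems.DssFarFieldSlavingBlowupTypeIDssProfileSmoothRepresentativeAe
import HarnessLib

/-!
# The sub-critical-strain cell is EMPTY — UNCONDITIONALLY (pub-ns-dss theory T32 / row E24, now a tree theorem)
  (route `DssFarFieldSlaving`, crux `BlowupTypeIDssProfile`, stmt-NavierStokesRegularity-0155 — SUPPORT;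
  cell pub-ns-dss, typer seat g3; the statement is the theory seat's T32 (EXPLICIT-THRESHOLDS.md v1.4,
  red-team ×2 PASS 2026-08-22T19:32:12Z); this file DISCHARGES the inline hypothesis `h` of the
  conditional wrapper `ExplicitThreshold.rdssClass_subcriticalStrain_empty` from tree theorems.)

HONEST FRAMING. A Liouville theorem with an explicit constant for the KNSS Oseen-gauge class, obtained
by COMPOSING three results already proved in this tree; no new analysis is done here and nothing here is
a statement about Navier–Stokes regularity or blow-up. An empty cell is a solver control / diagnosis.

* `typeI_ancient_subcriticalStrain_eq_zero` (classical, Oseen gauge — theory T32 verbatim): a Type-I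
  ancient mild field `V` (`IsTypeIAncientMild C V`: jointly smooth on `t < 0`, divergence-free, KNSS-mild,
  `‖V(t,x)‖ ≤ C/√(−t)`, ANY constant `C`) whose strain is sub-critical,
  `⟪∇V(t,x) ξ, ξ⟫ ≤ (Λ/(−t)) ‖ξ‖²` for all `ξ` with `Λ < 1` (i.e. `(−t) λ_max(S) ≤ Λ < 1`; the quadratic
  form of `∇V` only sees the symmetric part), vanishes identically. PROOF: the constant weight `h ≡ 1`
  with `δ = 1 − Λ > 0`, `A = 0` is a stretching certificate in the sense of route `SymmetryModuliCount`
  — at a point with `ω ≠ 0` and `ξ = ω/|ω|` (a unit vector), `(−t)(⟪∇V ξ, ξ⟫ − |∇ξ|²_F) − 1 + (1 − Λ)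
  ≤ Λ − 1 + 1 − Λ = 0` — so the weighted vorticity maximum principle `stretchCert_curl_eq_zero` gives
  `curl V ≡ 0`; bounded curl- and divergence-free `C²` slices are constant
  (`eq_of_curl_eq_zero_of_isDivFree_of_bounded`, KNSS 2009 Lemma 3.1) and the Oseen gauge kills
  slice-constant elements (`IsTypeIAncientMild.eq_zero_of_slice_const`, KNSS 2009 Remark 6.1). The
  tree's `clockStretchingLaw_smallStrainRung_proof` is the same argument with the cruder hypothesis
  `(−t)‖∇V‖_op ≤ ½`.
* `rdssClass_subcriticalStrain_empty` (CLASS level, E24): for every Type-I bound `M` and every `Λ < 1`,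
  no member `u` of the hypothesis class of `Theses.FilamentSkeletonRss.RdssProfileTruncation` (H0 `1 < c`,
  H5 ancient mild, H4 measurable slices, H2 `(c, R)`-RDSS, H3 `HasTypeIDecay M u`, H6 non-trivial) has
  all its smooth Type-I representatives `V` (`IsTypeIAncientMild M V`, `V t =ᵐ u t`; one exists by
  `typeI_ancient_smoothRepresentative_ae`) sub-critically strained. Same statement as the theory seat's
  conditional wrapper with the hypothesis `h` removed.

The forward (blow-up) form of the strain threshold is printed for Euler — Chae, J. Funct. Anal. 258
(2010) Thm 1.1, with Chae–Kang–Lee, DCDS 25 (2009) Rmk 1 (gradient → strain), and Chae's 2022 survey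
Thm 4.6; the ancient Navier–Stokes form was derived independently by the cell's lit and theory seats and
re-derived by the red team (their route: `|ω|²` is a subsolution of `∂_t W ≤ ΔW − V·∇W + 2λ_max(S) W`,
comparison `sup|ω(t)| ≤ sup|ω(t₀)| ((−t₀)/(−t))^Λ`, Type-I smoothing `sup|ω(t₀)| ≲ (−t₀)⁻¹`); the tree
route used here is the stretching-certificate maximum principle of `SymmetryModuliCount` (Constantin–
Fefferman-type weight, KNSS gradient bound, weak maximum principle with linear drift).
[cite: KochNadirashviliSereginSverak2009, Lemma 3.1 and Remark 6.1 (arXiv:0709.3599)]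
[cite: ConstantinFefferman1993, §1]
-/

noncomputable section

set_option linter.dupNamespace false

namespace Summit.NavierStokesRegularity.NavierStokesRegularity.Theorems.SubcriticalStrain

open Set Function Filter MeasureTheory
open scoped RealInnerProductSpace Laplacian ContDiff Topology
open Literature.Analysis Literature.Analysis.FluidPDE
open Summit.NavierStokesRegularity.NavierStokesRegularity.Theorems

/-- **The certificate inequality of the constant weight under a sub-critical strain bound.** If
`⟪L ξ, ξ⟫ ≤ (Λ/(−t)) ‖ξ‖²` for a unit vector `ξ` (`t < 0`) then for every `F ≥ 0`,
`((−t)(⟪L ξ, ξ⟫ − F) − 1 + (1 − Λ)) · 1 ≤ (−t) · (0 + 0 − 0)`. [folklore] -/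
theorem cert_ineq {t Λ : ℝ} (ht : t < 0)
    {L : EuclideanSpace ℝ (Fin 3) →L[ℝ] EuclideanSpace ℝ (Fin 3)} {ξ : EuclideanSpace ℝ (Fin 3)}
    (hξ : ‖ξ‖ = 1) (hL : ⟪L ξ, ξ⟫ ≤ Λ / (-t) * ‖ξ‖ ^ 2) {F : ℝ} (hF : 0 ≤ F) :
    ((-t) * (⟪L ξ, ξ⟫ - F) - 1 + (1 - Λ)) * (1 : ℝ) ≤ (-t) * ((0 : ℝ) + 0 - 0) := by
  have ht0 : 0 < -t := neg_pos.2 ht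
  have h1 : (-t) * ⟪L ξ, ξ⟫ ≤ Λ := by
    have htne : (-t) ≠ 0 := ht0.ne'
    have e : (-t) * (Λ / (-t) * ‖ξ‖ ^ 2) = Λ := by
      rw [hξ, one_pow, mul_one, ← mul_div_assoc, mul_div_cancel_left₀ Λ htne]
    calc (-t) * ⟪L ξ, ξ⟫ ≤ (-t) * (Λ / (-t) * ‖ξ‖ ^ 2) := mul_le_mul_of_nonneg_left hL ht0.le
      _ = Λ := e
  nlinarith [mul_nonneg ht0.le hF]

/-- **T32 (classical, Oseen gauge): sub-critical strain forces triviality.** A Type-I ancient mild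
field `V` in the KNSS gauge (any constant `C`) with `⟪∇V(t,x) ξ, ξ⟫ ≤ (Λ/(−t)) ‖ξ‖²` for all `t < 0`,
`x`, `ξ` and some `Λ < 1` vanishes for all `t < 0`. Proof: `h ≡ 1`, `δ = 1 − Λ`, `A = 0` is a
stretching certificate (`cert_ineq`), hence `curl V ≡ 0` (`stretchCert_curl_eq_zero`), the slices are
constant (`eq_of_curl_eq_zero_of_isDivFree_of_bounded`) and the gauge kills them
(`IsTypeIAncientMild.eq_zero_of_slice_const`). [cite: KochNadirashviliSereginSverak2009, Lemma 3.1 and Remark 6.1 (arXiv:0709.3599)] -/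
theorem typeI_ancient_subcriticalStrain_eq_zero {C Λ : ℝ} (hΛ : Λ < 1)
    {V : ℝ → EuclideanSpace ℝ (Fin 3) → EuclideanSpace ℝ (Fin 3)} (hV : IsTypeIAncientMild C V)
    (hstrain : ∀ t < 0, ∀ x ξ : EuclideanSpace ℝ (Fin 3),
      ⟪fderiv ℝ (V t) x ξ, ξ⟫ ≤ Λ / (-t) * ‖ξ‖ ^ 2) :
    ∀ t < 0, ∀ x, V t x = 0 := by
  intro t ht x
  -- the constant certificate `h ≡ 1`, `δ = 1 - Λ`, `A = 0`
  have hh : IsSmoothSpaceTimeOn (Iio 0) (fun (_ : ℝ) (_ : EuclideanSpace ℝ (Fin 3)) => (1 : ℝ)) :=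
    contDiffOn_const
  have hh1 : ∀ s < (0 : ℝ), ∀ (y : EuclideanSpace ℝ (Fin 3)),
      1 ≤ (fun (_ : ℝ) (_ : EuclideanSpace ℝ (Fin 3)) => (1 : ℝ)) s y := fun _ _ _ => le_rfl
  have hgrad1 : ∀ s < (0 : ℝ), ∀ (y : EuclideanSpace ℝ (Fin 3)),
      ‖fderiv ℝ ((fun (_ : ℝ) (_ : EuclideanSpace ℝ (Fin 3)) => (1 : ℝ)) s) y‖ ≤
        0 * (1 / Real.sqrt (-s) + ‖y‖ / (-s)) *
          (fun (_ : ℝ) (_ : EuclideanSpace ℝ (Fin 3)) => (1 : ℝ)) s y := by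
    intro s _ y
    simp
  have hcert : ∀ s < (0 : ℝ), ∀ (y : EuclideanSpace ℝ (Fin 3)), curl (V s) y ≠ 0 →
      ((-s) * (⟪fderiv ℝ (V s) y (vorticityDirection (curl (V s)) y),
          vorticityDirection (curl (V s)) y⟫
          - frobeniusNormSq (fderiv ℝ (vorticityDirection (curl (V s))) y)) - 1 + (1 - Λ)) *
          (fun (_ : ℝ) (_ : EuclideanSpace ℝ (Fin 3)) => (1 : ℝ)) s y ≤
        (-s) * (timeDeriv (fun (_ : ℝ) (_ : EuclideanSpace ℝ (Fin 3)) => (1 : ℝ)) s y +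
          fderiv ℝ ((fun (_ : ℝ) (_ : EuclideanSpace ℝ (Fin 3)) => (1 : ℝ)) s) y (V s y) -
          (Δ ((fun (_ : ℝ) (_ : EuclideanSpace ℝ (Fin 3)) => (1 : ℝ)) s)) y) := by
    intro s hs y hω
    have hξ : ‖vorticityDirection (curl (V s)) y‖ = 1 := by
      rw [vorticityDirection_apply, norm_smul, norm_inv, norm_norm,
        inv_mul_cancel₀ (norm_ne_zero_iff.2 hω)]
    have htd : timeDeriv (fun (_ : ℝ) (_ : EuclideanSpace ℝ (Fin 3)) => (1 : ℝ)) s y = 0 := by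
      simp [timeDeriv]
    have hfd : fderiv ℝ ((fun (_ : ℝ) (_ : EuclideanSpace ℝ (Fin 3)) => (1 : ℝ)) s) y (V s y) = 0 := by
      simp
    have hΔ : (Δ ((fun (_ : ℝ) (_ : EuclideanSpace ℝ (Fin 3)) => (1 : ℝ)) s)) y = 0 :=
      laplacian_const_eq_zero (1 : ℝ) y
    rw [htd, hfd, hΔ]
    exact cert_ineq hs hξ (hstrain s hs y _) (frobeniusNormSq_nonneg _)
  have hω : ∀ s < 0, ∀ y, curl (V s) y = 0 := fun s hs y =>
    stretchCert_curl_eq_zero hV hh hh1 (by linarith : (0 : ℝ) < 1 - Λ) hgrad1 hcert hs y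
  have hub : ∀ s < 0, ∀ y, V s y = V s 0 := fun s hs y =>
    eq_of_curl_eq_zero_of_isDivFree_of_bounded ((hV.contDiff_slice hs).of_le (by norm_cast))
      (hω s hs) (hV.isDivFree hs) (fun z => hV.norm_le hs z) y 0
  exact hV.eq_zero_of_slice_const hub ht x

/-- **E24 at CLASS level, UNCONDITIONAL: the sub-critical-strain cell of the hypothesis class of
`RdssProfileTruncation` is EMPTY.** For every Type-I bound `M` and every `Λ < 1` there is no member
(any factor `c > 1`, any twist `R`) all of whose smooth Type-I representatives `V`
(`IsTypeIAncientMild M V`, `V t =ᵐ u t` for `t < 0`) satisfy `⟪∇V(t,x) ξ, ξ⟫ ≤ (Λ/(−t)) ‖ξ‖²`.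
This is the theory seat's conditional wrapper `ExplicitThreshold.rdssClass_subcriticalStrain_empty`
with its hypothesis `h` (= T32) discharged by `typeI_ancient_subcriticalStrain_eq_zero`. [this file]
[cite: KochNadirashviliSereginSverak2009, Lemma 3.1 and Remark 6.1 (arXiv:0709.3599)] -/
theorem rdssClass_subcriticalStrain_empty (M : ℝ) {Λ : ℝ} (hΛ : Λ < 1) :
    ¬ ∃ (c : ℝ) (R : (EuclideanSpace ℝ (Fin 3)) ≃ₗᵢ[ℝ] (EuclideanSpace ℝ (Fin 3)))
        (u : ℝ → (EuclideanSpace ℝ (Fin 3)) → (EuclideanSpace ℝ (Fin 3))),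
      1 < c ∧ IsAncientMildSolution 1 u ∧ (∀ t < 0, AEStronglyMeasurable (u t) volume) ∧
      IsRotatedDSS c R u ∧ HasTypeIDecay M u ∧
      (∀ V : ℝ → EuclideanSpace ℝ (Fin 3) → EuclideanSpace ℝ (Fin 3), IsTypeIAncientMild M V →
        (∀ t < 0, V t =ᵐ[volume] u t) →
        ∀ t < 0, ∀ x ξ : EuclideanSpace ℝ (Fin 3),
          ⟪fderiv ℝ (V t) x ξ, ξ⟫ ≤ Λ / (-t) * ‖ξ‖ ^ 2) ∧
      ¬ (∀ t < 0, u t =ᵐ[volume] 0) := by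
  rintro ⟨c, R, u, -, hmild, hmeas, -, hdec, hstrain, hne⟩
  obtain ⟨V, hT, -, hVu, -⟩ := typeI_ancient_smoothRepresentative_ae hmild hmeas hdec
  have hz : ∀ t < 0, ∀ x, V t x = 0 :=
    typeI_ancient_subcriticalStrain_eq_zero hΛ hT (hstrain V hT hVu)
  refine hne fun t ht => ?_
  have hVz : V t = 0 := funext fun x => by simpa using hz t ht x
  exact (hVu t ht).symm.trans (Filter.EventuallyEq.of_eq hVz)

end Summit.NavierStokesRegularity.NavierStokesRegularity.Theorems.SubcriticalStrain

end
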